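import Literature.MathematicalPhysics.QuantumFieldTheory.Balaban1983to89.B9GeoNormsKLevelV1
import Literature.MathematicalPhysics.QuantumFieldTheory.Balaban1983to89.B9FromB6ModelSignsOn

/-!
# `Balaban1983to89.B9GeoNormsKLevelModelSignsV1` — T. Bałaban, *Propagators for lattice gauge theories in a background field*, Commun. Math. Phys. **99**
# (1985) 389–434 [Balaban1985BackgroundPropagators], Sect. A (3.39)–(3.41) p. 397: THE MODEL SIGN FACTS OF THE GEOMETRY READING `geo9K` OF A k-LEVEL
# V1 MEMBER, PACKAGED AS def-Y's `ModelSignsOn` (monotonicity of the Hölder functional in the exponent on the FINE-BOND summand)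

statement-level skeleton of published theorems with citation tags; proofs where landed; nothing here is a claim about the Yang–Mills mass gap

CITATION HEADER (lean-in-tree rule) — WHAT IS REPRODUCED.  Cell `pub-ymgap`, seat `pub-ymgap-dag-n03-b` (g2), typing hand of the interim definer of the
Stage-3′(Y) GEOMETRY layer (dag-n06-a «def-Y», director LINE №32); repair route R3 of the seat's note [N03B-G2-HAZARD-1] (the U = 1 edge
`B9FromB6.baseU1_of_B6` asks `ModelSigns.holder_mono` for ALL arguments, which FAILS for the torus-SITE summand of `Node00.kGeoU` — T8's all-pairs Hölder
functional `hqTP` is not monotone in the exponent; print's (3.40) takes `|x − x′| ≤ 1` only), as executed by def-Y's `B9FromB6ModelSignsOn.ModelSignsOn g P`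
(`holder_mono` asked only for arguments `lam` with `P lam`; the re-run `baseU1_of_B6_on` nulls the others through node00's `kGU.e4 (.inl _) := 0` readings).
THIS FILE: the instance for the geometry reading of record — `modelSignsOn_geo9K : ModelSignsOn (geo9K i) (fun lam => lam.isRight = true)`
(the predicate = the fine-bond summand, the arguments `J` of G = Δ_a⁻¹ in (3.44)∕(3.45)), from §6 of `B9GeoNormsKLevelV1` (nine sign facts on both summands + r03's
`holder_mono_exponent` on the bond summand); and the same for the Δ̃ variant `geo9KT`.  THEOREMS ONLY; no `instance`, no `notation`.
HONEST SCOPE: sign∕monotonicity bookkeeping of lattice functionals; nothing of [B9] asserted; count-neutral; NOT summit progress.  Unit `pub-ymgap-dag-n03-b` (gen 2), 2026-08-26.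
-/

noncomputable section

namespace Literature.MathematicalPhysics.QuantumFieldTheory.Balaban1983to89.B9GeoNormsKLevelModelSignsV1

open B6KLevelCensusIndexV1 (KIdx)
open B9GeoNormsKLevelV1
open B9FromB6ModelSignsOn (ModelSignsOn)

variable {d ℓ : ℕ} {hd : 1 ≤ d + 1} {hL : Odd (ℓ + 1) ∧ 1 < ℓ + 1} {b₀ b₁ : ℝ}

/-- **THE MODEL SIGNS OF THE GEOMETRY READING OF RECORD**: `geo9K i` satisfies def-Y's `ModelSignsOn` with `holder_mono` on the bond summand
(`L, η, d, |·|, ‖·‖, |·|_{(γ)}, ‖·‖_ε, ‖ζ‖_β + |ζ|, |h| ≥ 0` on both summands; `‖J‖_ε ≤ ‖J‖_{ε′}` for `ε ≤ ε′` on fine-bond `J` — r03's `holder_mono_exponent`: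
the bond-summand functional is a sup over ADMISSIBLE pairs only (`B6KLevelCensusIndexV1.Adm`: same direction, `|x − x′|_∞ ≤ L^{j(y(x))}`), normalised by
`tpar = |x − x′|_∞ ∕ L^{j(y(x))} ≤ 1` (`tpar_le_one`) — print's «|x − x′| ≤ 1 at the scale ξ», so `t^{−ε}` IS non-decreasing in ε and ref-A's landing check
(«all pairs of the sup at distance ≤ 1») is met by construction).
[cite: Balaban1985BackgroundPropagators, Sect. A (3.39)–(3.41) p.397, (3.44)–(3.45) p.398] -/
theorem modelSignsOn_geo9K (i : KIdx d ℓ hd hL b₀ b₁) : ModelSignsOn (geo9K i) (fun lam => lam.isRight = true) where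
  L_nonneg := geo9K_L_nonneg i
  eta_nonneg := geo9K_eta_nonneg i
  dist_nonneg := geo9K_dist_nonneg i
  supNorm_nonneg := geo9K_supNorm_nonneg i
  l2Norm_nonneg := geo9K_l2Norm_nonneg i
  wNorm_nonneg := geo9K_wNorm_nonneg i
  holder_nonneg := geo9K_holder_nonneg i
  holder_mono_on := by
    intro ε ε' lam hP hεε
    cases lam with
    | inl f => exact absurd hP (by simp)
    | inr J => exact geo9K_holder_mono_bond i hεε J
  cutH_nonneg := geo9K_cutH_nonneg i
  cutSup_nonneg := geo9K_cutSup_nonneg i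

/-- the same for the Δ̃ variant `geo9KT` (identical norm fields). [cite: Balaban1985BackgroundPropagators, Sect. A (3.39)–(3.41) p.397] -/
theorem modelSignsOn_geo9KT (i : KIdx d ℓ hd hL b₀ b₁) : ModelSignsOn (geo9KT i) (fun lam => lam.isRight = true) :=
  { (modelSignsOn_geo9K i) with }

end Literature.MathematicalPhysics.QuantumFieldTheory.Balaban1983to89.B9GeoNormsKLevelModelSignsV1

end
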